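import Mathlib
import HarnessLib
import HarnessLib.Audit
import Summits.AtomisticToContinuum.Statement

/-!
Route: DenseKineticExpansion

CLOSED (retired) 2026-08-15T13:41:48Z by operator:999:1257524 — reason: not-a-thesis: assembly does not conclude the sub-problem Statement — note: D-0027 §2.1 audit (human 2026-08-15: routes that do not decide the summit are removed): the assembly concludes `Literature.MathematicalPhysics.KineticTheory.HydrodynamicLimit`, not the sub-problem statement; a NEW conforming route may be opened from the same idea (generated `closes : … → _root_.Hydr. The file is kept as the record of this route; refuted decls are indexed as negative knowledge (`ledger negatives`).

X_DK (DENSE KINETIC EXPANSION; it suffices to show): at small but FIXED reduced density σ³ the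
Deng–Hani–Ma cumulant
("molecule"/layered cluster-forest) expansion of the hard-sphere correlation functions converges
uniformly on macroscopic
time intervals [0, t] ⊂ [0, T) before the first shock, with the Boltzmann hierarchy replaced by an
Enskog-type hierarchy
(collision operator evaluated at contact distance σ(N+1)^{-1/3} with the local hard-sphere contact
correlation), and the
hydrodynamic (Hilbert/Caflisch) expansion of that hierarchy around local Maxwellians is driven by
the classical Euler
solution with the FULL hard-sphere equation of state p = ρθ Z(ρσ³). CONSEQUENCE (typed shadow, decl
L2HydroFields): the
one- and two-point cumulants of the time-t law are controlled well enough that the empirical density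
/ momentum / energy
fields converge to (ρ, ρu, E)(t) in MEAN SQUARE:
  ∀ profiles ∃ σ₀ ∀ σ ∈ (0,σ₀) ∀ classical hs-Euler (ρ,u,θ) on [0,T) ∀ flows Φ, fields converge at 0
→
  ∀ t ∈ Ico 0 T, ∀ χ continuous, ∫⁻ |empiricalDensityField (Φ_N,t z) χ − ∫χρ_t|² d(localGibbsLaw σ
a₀ u₀ θ₀ N) → 0 (in ℝ≥0∞),
  and likewise for the momentum (‖·‖²) and energy fields.
L2HydroFields → HydrodynamicLimit by Chebyshev (assembly item).
This is the natural continuation of DengHaniMa2024 (arXiv:2408.07818 Thm 1; arXiv:2503.01800 Thm 3: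
compressible Euler
with IDEAL-GAS law in the ITERATED limit N → ∞ at fixed α = Nε², then α → ∞, or α ≤ (log|log
ε|)^{1/2-}) from the
dilute regime Nε³ → 0 to Nε³ = σ³ > 0 fixed, where α = σ² N^{1/3} is a POWER of N.

Rationale: WHY THIS LINE. PROBLEMS.md §3 [HydrodynamicLimit] names it: the Deng–Hani–Ma programme
(DengHaniMa2024 = arXiv:2408.07818,
long-time Boltzmann; arXiv:2503.01800 Thm 3, compressible Euler with ideal-gas law) reaches only the
DILUTE regime
(Nε³ → 0, α = Nε^{d-1} ≤ (log|log ε|)^{1/2-}) and gets Euler in an ITERATED limit; the conjunct sits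
at Nε³ = σ³ fixed,
α = σ²N^{1/3}. The kinetic route to fixed density is: (i) replace propagation of chaos by an
ENSKOG-type structure —
two-particle correlations at contact do not vanish but are the local-equilibrium hard-sphere contact
correlation g(σ⁺;ρσ³);
this is exactly what turns the ideal-gas pressure into ρθZ(ρσ³) (virial theorem; revised Enskog
theory of van Beijeren–
Ernst 1973, H-theorem of Résibois 1978, whose equilibria are the exact hard-sphere Gibbs states);
(ii) show the DHM
cumulant bounds survive at positive volume fraction on the Euler time-scale because only LOCAL
EQUILIBRIUM information is
needed at Euler order (transport coefficients, where Enskog is NOT exact, enter at O(Kn) =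
O(N^{-1/3})). Imported area:
combinatorics of Feynman-diagram-like collision histories (DHM molecules, PulvirentiSimonella2016
correlation-error
expansion, BGSS2023 cluster/cumulant expansions) + equilibrium cluster expansions at small packing
fraction
(LebowitzPenrose1964, Ruelle1969 Ch. 4). brief=widen: diagrammatic/cluster-expansion technology in a
regime where it has
never been made to converge.

RANKED CRUXES.
 2. FixedFractionCumulantExpansion [informal]: uniform-in-N bounds on the s-point cumulants of the
time-t law of hard
    spheres at Nε³ = σ³ ≤ σ₀³ on [0, t] ⊂ [0, T): |E_s(t)| ≤ (Cσ³)^{s-1} in the norms of DHM §1,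
with the reference
    (uncorrelated) state replaced by the local hard-sphere Gibbs state — i.e. cumulants RELATIVE TO
LOCAL EQUILIBRIUM are
    small, not cumulants relative to a product state.
 3. EnskogHydrodynamics [informal]: the resulting one-particle equation (Enskog-type collision
operator with contact
    correlation χ(ρσ³) and spatial shifts ±ε) has, for well-prepared local-Maxwellian data and Kn =
N^{-1/3} → 0, solutions
    whose moments converge to the classical hs-Euler solution before the first shock (Caflisch 1980
/ Guo–Jang–Jiang-type
    Hilbert expansion, with EOS ρθZ).
 4. MarginalsToL2 [informal→typable]: weighted L¹ convergence of the 1-marginal to ρ_t M_{u_t,θ_t}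
with weight (1+|v|²)
    and of the 2-marginal to its product (off contact) ⇒ L2HydroFields (variance computation; needs
permutation symmetry
    of lawAt, i.e. an equivariant choice of HardSphereFlow or a symmetrised statement).
 TARGET [typed] L2HydroFields (rank 0); ASSEMBLY [typed] L2HydroFields →
Literature.MathematicalPhysics.KineticTheory.HydrodynamicLimit (Chebyshev in ℝ≥0∞).
 SUPPORT: HsEosLowDensity, LocalGibbsConcentration (filed on route RelEntropyErgodic; shared).
KILL CRITERIA. A theorem that at any fixed σ > 0 the dynamical cumulants relative to local
equilibrium are NOT summable on
the Euler time-scale (e.g. a lower bound ≥ c > 0 on the connected two-point function at macroscopic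
separation for
t ~ 1, from long-time-tail / ring-collision resummation) closes crux 2 and this route.
¬L2HydroFields with
HydrodynamicLimit still open would only say fluctuations are non-Gaussian-large — closes the route,
not the conjunct.
NOT DECOMPOSED YET: the Enskog hierarchy as a Lean object; the norms; d = 3 only; the treatment of
the initial layer
(local Gibbs data are already in local equilibrium, so no initial layer is expected). Wait for crux
2.
SOURCES: DengHaniMa2024 (both eprints; Thm 1, Thm 3 read via lit, p.3, p.6);
PulvirentiSimonella2016; BGSS2023; Lanford1975;
GST2013; CIP1994 §4; LebowitzPenrose1964; Ruelle1969; van Beijeren–Ernst, Physica 68 (1973) 437;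
Résibois, J. Stat.
Phys. 19 (1978) 593; Caflisch, CPAM 33 (1980) 651.

Novelty: NOVELTY (retriage 2026-08-14; searched first: lit frontier/bridges, lit search --hybrid x2, lit
vsearch x2, crossref sweeps Lachowicz/van
Beijeren-Ernst/Resibois/Arkeryd/Caflisch/Guo-Jang-Jiang/Pulvirenti-Simonella/BGSS/Rezakhanlou;
OpenAlex/S2/arXiv 429). Nearest prior art: (1) DengHaniMa2024 = arXiv:2408.07818 Thm 1 +
arXiv:2503.01800 Thm 3 p11, regime (1.24) p8: Euler with IDEAL-GAS law, α = δ⁻¹ ≲ (log|log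
ε|)^{1/2}, iterated limit; here (N+1)ε³ = σ³ is FIXED (α = σ²N^{1/3}) and p = ρθZ(ρσ³). (2)
Kinetic→fluid at fixed b = σ³: Lachowicz1988, Lachowicz1998 Thm 4.1 (Y ≡ 1, near global equilibrium,
[0,t₀]); Caflisch1980 (Boltzmann, pre-shock); crux EnskogHydrodynamics asks the revised Enskog
(VanbeijerenErnst1973, Resibois1978), large data, up to the shock. (3) Particles→Enskog is proved
only for STOCHASTIC collision models (Rezakhanlou2003, doi:10.1007/s10955-017-1743-9); for
deterministic spheres "it cannot be derived from the Liouville formalism" (Soto2016 p122;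
CIPDiluteGases1994 p39). (4) Dynamical cumulant/cluster expansions of hard spheres:
PulvirentiSimonella2016 Thm 2.4, doi:10.1007/s10955-013-0905-7, doi:10.1063/5.0091199, BGSSCPAM2023,
all Boltzmann–Grad. DELTA: DHM-type cumulants re-centred on the LOCAL hard-sphere Gibbs state,
summed on Euler times at fixed σ³, Enskog contact closure carrying the full EOS; nothing printed
attempts this regime (static input: LebowitzPenrose1964, Ruelle1969 Thm 4.4.8). Grade guess:
new-combination.  [refs: 10.1007/s10955-017-1743-9, 10.1007/s10955-013-0905-7, 10.1063/5.0091199, 2408.07818, 2503.01800, doi:10.1007/s10955-017-1743-9, doi:10.1007/s10955-013-0905-7, doi:10.1063/5.0091199, DengHaniMa2024, Lachowicz1988, Lachowicz1998, Caflisch1980, VanbeijerenErnst1973, Resibois1978, Rezakhanlou2003, Soto2016, CIPDiluteGases1994, PulvirentiSimonella2016, BGSSCPAM2023, LebowitzPenrose1964, Ruelle1969]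

Barriers (technique_class: bbgky cumulant-expansion density-expansion hilbert-expansion): BARRIERS (retriage 2026-08-14; 44 catalogue decls read, 9 on HydrodynamicLimit).
technique_class: bbgky cumulant-expansion density-expansion hilbert-expansion
- Literature.Barriers.AtomisticToContinuum.NoDensityExpansionBarrier: APPLIES (blocks (2) names this
route). Clause (1) non-analytic transport: not met (Euler level; transport is O(Kn) = O(N^{-1/3});
scope (c)-(d)). Clause (2) term-by-term dynamical cluster expansions grow like (t/t_c)^{l-2} over
the ≍N^{1/3} mean free times of an Euler time unit: NOT evaded by DHM's expansion as printed (gain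
ε^{α|H|} absent at fixed σ); the bet = its evasions (i)+(iii): cumulants RELATIVE TO the local
hs-Gibbs/Enskog reference (zero at t = 0), re-expanded in layers ≪ mean free time, a resummation
whose completeness "has not been proved" (Cohen1967 §4c-d) = crux FixedFractionCumulantExpansion =
kill criterion.
- Literature.Barriers.AtomisticToContinuum.DiluteRegimeBarrier: APPLIES to Newton→Boltzmann→Euler
(ideal gas). Evaded in form (no Boltzmann–Grad limit; σ³ fixed; Enskog-type hierarchy, Euler closure
= hsPressure; its scope (1): positive-density expansions not excluded in print); in substance the
particle→kinetic step is the same open crux.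
- Literature.Barriers.AtomisticToContinuum.BoltzmannHypothesisBarrier: no entropy method here, but
same physical input (local equilibrium on Euler times), sought perturbatively in σ³ ≪ 1; documented
obstruction, not a no-go.
- Literature.Barriers.AtomisticToContinuum.HighMomentumCutoffBarrier:

History (route lifecycle, newest last):
- 2026-08-15T13:41:48Z · CLOSED retired — not-a-thesis: assembly does not conclude the sub-problem Statement (operator:999:1257524)

sub-problem: HydrodynamicLimit · status: closed(retired) · opened planner-plan-AtomisticToContinuum-HydrodynamicLimit-0 2026-08-13T19:12:01Z · rev 2 · ledger route-AtomisticToContinuum-DenseKineticExpansion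
GENERATED by the gate from the ledger (D-0016/17). Provers cite these decls: `theorem foo : Summit.AtomisticToContinuum.HydrodynamicLimit.Theses.DenseKineticExpansion.<Decl> := …` in Summits/AtomisticToContinuum/HydrodynamicLimit/Theorems/<Name>.lean.
-/

namespace Summit.AtomisticToContinuum.HydrodynamicLimit.Theses.DenseKineticExpansion

open scoped BigOperators Topology Manifold Classical MeasureTheory ProbabilityTheory Matrix InnerProductSpace ComplexConjugate ContinuousMap
open Filter Set Function TopologicalSpace MeasureTheory

attribute [summit_statement] _root_.HydrodynamicLimit

/-- item stmt-AtomisticToContinuum-0800 · target · rank 0 · closed · moot by None · by planner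
why it might fail: In substance the open conjunct itself (uniform integrability is automatic by energy conservation): deterministic spheres at fixed σ>0 may fail to reach/keep local equilibrium on Euler times; no dynamical-mixing theorem (Spohn1991 PDF p11), only weak-noise dynamics (OllaVaradhanYau1993 Thm 1.1).
sources: Spohn1991 Part I Ch.3, PDF p11 ('we do not know how to prove such a good dynamical mixing'), OllaVaradhanYau1993 Thm 1.1 (weak noise only), Literature.MathematicalPhysics.KineticTheory.HydrodynamicLimit (HardSphereEuler.lean)
[target] Mean-square hydrodynamic limit (typed shadow of one- and two-point cumulant control): for
all continuous profiles ∃ σ₀ ∀ σ<σ₀ ∀ classical hs-Euler solutions on [0,T) ∀ flows, if the local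
Gibbs fields converge at t = 0 then for every t < T and continuous χ the lower integrals ∫⁻ |density
field(Φ_t z; χ) − ∫χρ_t|², ∫⁻ ‖momentum field − ∫χρ_t u_t‖², ∫⁻ |energy field − ∫χE_t|² against
localGibbsLaw σ a₀ u₀ θ₀ N tend to 0 in ℝ≥0∞ (lintegral: no Bochner junk). Stronger than
TendstoHydroFieldsAt (adds uniform integrability); delivered by 1-marginal → local Maxwellian in
(1+|v|²)-weighted L¹ and 2-marginal → product. -/
@[route_item "route-AtomisticToContinuum-DenseKineticExpansion"]
def L2HydroFields : Prop :=
  ∀ (a₀ θ₀ : Literature.MathematicalPhysics.KineticTheory.T3 → ℝ) (u₀ : Literature.MathematicalPhysics.KineticTheory.T3 → Literature.MathematicalPhysics.KineticTheory.V3), Continuous a₀ → Continuous θ₀ → Continuous u₀ → (∀ x, 0 < a₀ x) → (∀ x, 0 < θ₀ x) → ∃ σ₀ : ℝ, 0 < σ₀ ∧ ∀ σ : ℝ, 0 < σ → σ < σ₀ → ∀ (T : ℝ) (ρ θ : ℝ → Literature.MathematicalPhysics.KineticTheory.T3 → ℝ) (u : ℝ → Literature.MathematicalPhysics.KineticTheory.T3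 → Literature.MathematicalPhysics.KineticTheory.V3), Literature.MathematicalPhysics.KineticTheory.IsHardSphereEulerSolution σ T ρ u θ → ∀ Φ : (N : ℕ) → Literature.Analysis.FluidPDE.HardSphereFlow (Literature.Analysis.FluidPDE.Torus.geometry (Fin 3)) (Literature.MathematicalPhysics.KineticTheory.hsDiameter σ N) (N + 1), Literature.MathematicalPhysics.KineticTheory.TendstoHydroFieldsAt (fun N => Literature.MathematicalPhysics.KineticTheory.localGibbsLaw σ a₀ u₀ θ₀ N (Φ N)) Φ ρ u θ 0 → ∀ t ∈ Set.Ico 0 T, ∀ χ : Literature.MathematicalPhysics.KineticTheory.T3 → ℝ, Continuous χ → Filter.Tendsto (fun N : ℕ => ∫⁻ z, ENNReal.ofReal (|Literature.MathematicalPhysics.KineticTheory.empiricalDensityField ((Φ N).flow t z) χ - ∫ x, χ x * ρ t x| ^ 2) ∂(Literature.MathematicalPhysics.KineticTheory.localGibbsLaw σ a₀ u₀ θ₀ N (Φ N))) Filter.atTop (nhds 0) ∧ Filter.Tendsto (fun N : ℕ => ∫⁻ z, ENNReal.ofReal (‖Literature.MathematicalPhysics.KineticTheory.empiricalMomentumField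 ((Φ N).flow t z) χ - ∫ x, (χ x * ρ t x) • u t x‖ ^ 2) ∂(Literature.MathematicalPhysics.KineticTheory.localGibbsLaw σ a₀ u₀ θ₀ N (Φ N))) Filter.atTop (nhds 0) ∧ Filter.Tendsto (fun N : ℕ => ∫⁻ z, ENNReal.ofReal (|Literature.MathematicalPhysics.KineticTheory.empiricalEnergyField ((Φ N).flow t z) χ - ∫ x, χ x * Literature.MathematicalPhysics.KineticTheory.totalEnergyDensity (ρ t x) (u t x) (θ t x)| ^ 2) ∂(Literature.MathematicalPhysics.KineticTheory.localGibbsLaw σ a₀ u₀ θ₀ N (Φ N))) Filter.atTop (nhds 0)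

/-- item stmt-AtomisticToContinuum-0804 · crux · rank 2 · closed · moot by None · by planner
why it might fail: No small parameter at fixed σ: α=σ²N^{1/3} but DHM need α≲(log|log ε|)^{1/2} (arXiv:2503.01800 (1.24)); recollisions/rings are O(1) per mean free time and term-by-term dynamical cluster expansions grow like (t/t_c)^{l−2} (Cohen1967 (11b)) over the ≍N^{1/3} mean free times of an Euler time unit.
sources: arXiv:2503.01800 (1.24) p8, Thm 3 p11, Rem 1.5(2) p7, arXiv:2408.07818 §1.3 (1.19)-(1.21) pp9-10, Cohen1967 §2 (11a)-(11b), §4a, §4c-d, Dorfman1999 p19 (no virial expansion of non-equilibrium properties), PulvirentiSimonella2016 Thm 2.4 (correlation error, Boltzmann–Grad, short time), BGSSCPAM2023 Thm 1.1; doi:10.1063/5.0091199 (dynamical cluster expansion, dilute)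
[crux] CUMULANT EXPANSION AT FIXED VOLUME FRACTION: there is σ₀ > 0 such that for σ < σ₀, local
Gibbs data (a₀,u₀,θ₀), a classical hs-Euler solution on [0,T) and t < T, the s-point cumulants
E_s(τ), τ ∈ [0,t], of the law of N+1 hard spheres of diameter σ(N+1)^{-1/3} on 𝕋³, taken RELATIVE TO
THE LOCAL HARD-SPHERE GIBBS STATE with the block-averaged conserved fields (not relative to a
product state), obey |E_s(τ)| ≤ (Cσ³)^{s−1} uniformly in N in DHM-type weighted L¹ norms
(DengHaniMa2024 arXiv:2408.07818 §1.3; layered cluster-forest / molecule expansion and cutting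
algorithm), although α = Nε² = σ²N^{1/3} is a power of N and Nε³ = σ³ does not vanish. Content:
recollision/long-bond combinatorics must be resummed against local equilibrium (Enskog contact
correlation), cf. PulvirentiSimonella2016 (correlation error at Boltzmann–Grad), BGSS2023 (dynamical
cluster expansion near equilibrium). Refutation (non-summable cumulants relative to local
equilibrium at every fixed σ > 0 on the Euler time scale) closes this route. -/
@[route_item "route-AtomisticToContinuum-DenseKineticExpansion"]
def FixedFractionCumulantExpansion : Prop :=
  ∀ (a₀ θ₀ : Literature.MathematicalPhysics.KineticTheory.T3 → ℝ) (u₀ : Literature.MathematicalPhysics.KineticTheory.T3 → Literature.MathematicalPhysics.KineticTheory.V3), Continuous a₀ → Continuous θ₀ → Continuous u₀ → (∀ x, 0 < a₀ x) → (∀ x, 0 < θ₀ x) → ∃ σ₀ : ℝ, 0 < σ₀ ∧ ∀ σ : ℝ, 0 < σ → σ < σ₀ → ∀ (T : ℝ) (ρ θ : ℝ → Literature.MathematicalPhysics.KineticTheory.T3 → ℝ) (u : ℝ → Literature.MathematicalPhysics.KineticTheory.T3 → Literature.MathematicalPhysics.KineticTheory.V3), Literature.MathematicalPhysics.KineticTheory.IsHardSphereEulerSolution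 σ T ρ u θ → ∀ Φ : (N : ℕ) → Literature.Analysis.FluidPDE.HardSphereFlow (Literature.Analysis.FluidPDE.Torus.geometry (Fin 3)) (Literature.MathematicalPhysics.KineticTheory.hsDiameter σ N) (N + 1), Literature.MathematicalPhysics.KineticTheory.TendstoHydroFieldsAt (fun N => Literature.MathematicalPhysics.KineticTheory.localGibbsLaw σ a₀ u₀ θ₀ N (Φ N)) Φ ρ u θ 0 → ∀ t ∈ Set.Ico 0 T, let W : (N : ℕ) → Literature.Analysis.FluidPDE.Config (N + 1) (Fin 3) Literature.MathematicalPhysics.KineticTheory.T3 → ℝ := fun N => (Literature.Analysis.FluidPDE.hardSphereDomain (Literature.Analysis.FluidPDE.Torus.geometry (Fin 3)) (N + 1) (Literature.MathematicalPhysics.KineticTheory.hsDiameter σ N)).indicator (Literature.Analysis.FluidPDE.hsTransport (Φ N) t (Literature.Analysis.FluidPDE.canonicalDensity (Literature.Analysis.FluidPDE.Torus.geometry (Fin 3)) (Literature.MathematicalPhysics.KineticTheory.hsDiameter σ N) (N + 1) (Literature.MathematicalPhysics.KineticTheory.localGibbsProfile a₀ u₀ θ₀))); let g : Literature.MathematicalPhysics.KineticTheory.T3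 × Literature.MathematicalPhysics.KineticTheory.V3 → ℝ := fun y => ρ t y.1 * Literature.Analysis.FluidPDE.localMaxwellian 1 (θ t y.1) (u t y.1) y.2; Filter.Tendsto (fun N : ℕ => ∫⁻ y : Literature.MathematicalPhysics.KineticTheory.T3 × Literature.MathematicalPhysics.KineticTheory.V3, ENNReal.ofReal ((1 + ‖y.2‖ ^ 2) ^ 2 * |Literature.Analysis.FluidPDE.nthMarginal (N + 1) 1 (W N) (fun _ => y) - g y|)) Filter.atTop (nhds 0) ∧ Filter.Tendsto (fun N : ℕ => ∫⁻ p : (Literature.MathematicalPhysics.KineticTheory.T3 × Literature.MathematicalPhysics.KineticTheory.V3) × (Literature.MathematicalPhysics.KineticTheory.T3 × Literature.MathematicalPhysics.KineticTheory.V3), ENNReal.ofReal ((1 + ‖p.1.2‖ ^ 2) * (1 + ‖p.2.2‖ ^ 2) * |Literature.Analysis.FluidPDE.nthMarginal (N + 1) 2 (W N) ![p.1, p.2] - Literature.Analysis.FluidPDE.nthMarginal (N + 1) 1 (W N) ![p.1] * Literature.Analysis.FluidPDE.nthMarginal (N + 1) 1 (W N) ![p.2]|)) Filter.atTop (nhds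 0)

/-- item stmt-AtomisticToContinuum-0805 · crux · rank 3 · closed · moot by None · by planner
why it might fail: Print has Enskog→Euler only for Y≡1, near global equilibrium, short time (Lachowicz1998 Thm 4.1; Hilbert procedure for b=const open, p195); large data up to the shock with χ from hsCompressibility is new. As typed ρσ³ is unbounded: for η>6/π, Z=1 and Y=0 (junk) ⇒ free transport ≠ Euler (shear flow).
sources: Lachowicz1998 Thm 3.1 p205, Thm 4.1 p208, p195 (read by grounders g9-1/g9-3; acq-00061), Lachowicz1988 (doi:10.1007/bf00251460), Caflisch1980 (doi:10.1002/cpa.3160330506): Boltzmann→Euler pre-shock, truncated Hilbert expansion, GuoJangJiang2009 (doi:10.3934/krm.2009.2.205): positivity of Hilbert-expansion solutions needs prepared data, VanbeijerenErnst1973; Resibois1978 (revised Enskog, H-theorem, hs-Gibbs equilibria), Arkeryd1990; ArkerydCercignani1990 (large-data Enskog existence, constant/symmetrised Y)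
[crux] ENSKOG-TYPE HIERARCHY → hs-EULER BEFORE SHOCKS: the limiting one-particle description
produced by crux FixedFractionCumulantExpansion — free transport plus a hard-sphere collision
operator evaluated at contact (spatial shifts ± ε ω, ε = σ(N+1)^{-1/3}) weighted by the
local-equilibrium contact value χ(ρσ³) of the pair correlation (revised Enskog structure, van
Beijeren–Ernst 1973; Résibois 1978 H-theorem: its equilibria are the exact hard-sphere Gibbs states,
so its Euler closure has p = ρθ·hsCompressibility(ρσ³)) — admits, for local-Maxwellian data
ρ₀M_{u₀,θ₀} and Knudsen number N^{-1/3} → 0, solutions on [0,t] ⊂ [0,T) whose (1, v, |v|²/2)-moments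
converge in (1+|v|²)-weighted L¹ to those of the local Maxwellian of the classical hs-Euler solution
(Hilbert/Caflisch expansion: Caflisch CPAM 33 (1980) 651 for Boltzmann → compressible Euler;
Guo–Jang–Jiang; Lachowicz for Enskog → Euler formally). Needs HsEosLowDensity (smooth EOS) and a
definition of the Enskog collision operator on 𝕋³ (definition request deferred until crux 2 moves). -/
@[route_item "route-AtomisticToContinuum-DenseKineticExpansion"]
def EnskogHydrodynamics : Prop :=
  ∃ σ₀ : ℝ, 0 < σ₀ ∧ ∀ σ : ℝ, 0 < σ → σ < σ₀ → ∀ (T : ℝ) (ρ θ : ℝ → Literature.MathematicalPhysics.KineticTheory.T3 → ℝ) (u : ℝ → Literature.MathematicalPhysics.KineticTheory.T3 → Literature.MathematicalPhysics.KineticTheory.V3), Literature.MathematicalPhysics.KineticTheory.IsHardSphereEulerSolution σ T ρ u θ → ∀ t ∈ Set.Ico 0 T, let G : Literature.Analysis.FluidPDE.Geometry (Fin 3) Literature.MathematicalPhysics.KineticTheory.T3 := Literature.Analysis.FluidPDE.Torus.geometry (Fin 3); let M : ℝ → Literature.MathematicalPhysics.KineticTheory.T3 × Literature.MathematicalPhysics.KineticTheory.V3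 → ℝ := fun τ y => ρ τ y.1 * Literature.Analysis.FluidPDE.localMaxwellian 1 (θ τ y.1) (u τ y.1) y.2; let Y : ℝ → ℝ := fun η => if η = 0 then 1 else (Literature.MathematicalPhysics.KineticTheory.hsCompressibility η - 1) / (2 * Real.pi / 3 * η); let clos : (Literature.MathematicalPhysics.KineticTheory.T3 × Literature.MathematicalPhysics.KineticTheory.V3 → ℝ) → Literature.Analysis.FluidPDE.Config 2 (Fin 3) Literature.MathematicalPhysics.KineticTheory.T3 → ℝ := fun h Z => Y (σ ^ 3 * ∫ w, h (G.translate (Z 1).1 ((1 / 2 : ℝ) • G.sepVec (Z 0).1 (Z 1).1), w)) * h (Z 0) * h (Z 1); let Ens : ℕ → (Literature.MathematicalPhysics.KineticTheory.T3 × Literature.MathematicalPhysics.KineticTheory.V3 → ℝ) → Literature.MathematicalPhysics.KineticTheory.T3 × Literature.MathematicalPhysics.KineticTheory.V3 → ℝ := fun N h y => Literature.Analysis.FluidPDE.bbgkyCollisionOp G (Literature.MathematicalPhysics.KineticTheory.hsDiameter σ N) N 1 0 (clos h) (fun _ => y); let S : ℝ → (Literature.MathematicalPhysics.KineticTheory.T3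 × Literature.MathematicalPhysics.KineticTheory.V3 → ℝ) → Literature.MathematicalPhysics.KineticTheory.T3 × Literature.MathematicalPhysics.KineticTheory.V3 → ℝ := fun τ h y => h (G.translate y.1 ((-τ) • y.2), y.2); ∃ f : ℕ → ℝ → Literature.MathematicalPhysics.KineticTheory.T3 × Literature.MathematicalPhysics.KineticTheory.V3 → ℝ, ∃ N₀ : ℕ, (∀ N, N₀ ≤ N → (∀ τ y, 0 ≤ f N τ y) ∧ (∀ τ ∈ Set.Icc 0 t, MeasureTheory.Integrable (fun y : Literature.MathematicalPhysics.KineticTheory.T3 × Literature.MathematicalPhysics.KineticTheory.V3 => (1 + ‖y.2‖ ^ 2) ^ 2 * f N τ y)) ∧ f N 0 = M 0 ∧ ∀ τ ∈ Set.Icc 0 t, ∀ y, f N τ y = S τ (f N 0) y + ∫ s in (0 : ℝ)..τ, S (τ - s) (Ens N (f N s)) y) ∧ Filter.Tendsto (fun N : ℕ => ∫⁻ y : Literature.MathematicalPhysics.KineticTheory.T3 × Literature.MathematicalPhysics.KineticTheory.V3, ENNReal.ofReal ((1 + ‖y.2‖ ^ 2) ^ 2 * |f N t y - M t y|)) Filter.atTop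 (nhds 0)

/-- item stmt-AtomisticToContinuum-0806 · support · rank 4 · closed · moot by None · by planner
[crux→typable] MARGINALS ⇒ MEAN SQUARE: if for t < T the 1-particle marginal f¹_N(t) of the time-t
density (transportFn Φ_N of canonicalDensity … (localGibbsProfile a₀ u₀ θ₀)) converges to g_t(x,v) =
ρ_t(x)·localMaxwellian 1 (θ_t x) (u_t x) v in L¹((1+|v|²)dx dv) and the 2-particle marginal f²_N(t)
− f¹_N(t)⊗f¹_N(t) → 0 in L¹((1+|v|²)(1+|v′|²)), then L2HydroFields holds at t (E|N⁻¹Σφ(z_i) − ∫φg|²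
= N⁻¹∫φ²f¹ + (1−N⁻¹)∫φ⊗φ f² − 2∫φf¹∫φg + (∫φg)², φ ∈ {χ, χv, χ|v|²/2}; Sznitman1991 Prop. 2.2 with
unbounded tests). CAVEAT for the typed version: Literature.Analysis.FluidPDE.HardSphereFlow carries
no permutation-equivariance field, so symmetry of the time-t density must be assumed (symmetrised
marginals) or an equivariant flow chosen (flows agree a.e., HardSphereFlow.flow_eq_ae); grounder to
set-signature accordingly. -/
@[route_item "route-AtomisticToContinuum-DenseKineticExpansion"]
def MarginalsToL2 : Prop :=
  ∀ (σ : ℝ) (a₀ θ₀ : Literature.MathematicalPhysics.KineticTheory.T3 → ℝ) (u₀ : Literature.MathematicalPhysics.KineticTheory.T3 → Literature.MathematicalPhysics.KineticTheory.V3) (ρ θ : ℝ → Literature.MathematicalPhysics.KineticTheory.T3 → ℝ) (u : ℝ → Literature.MathematicalPhysics.KineticTheory.T3 → Literature.MathematicalPhysics.KineticTheory.V3) (Φ : (N : ℕ) → Literature.Analysis.FluidPDE.HardSphereFlow (Literature.Analysis.FluidPDE.Torus.geometry (Fin 3)) (Literature.MathematicalPhysics.KineticTheory.hsDiameter σ N)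 (N + 1)) (t : ℝ), 0 < σ → Continuous a₀ → Continuous θ₀ → Continuous u₀ → (∀ x, 0 < a₀ x) → (∀ x, 0 < θ₀ x) → Continuous (ρ t) → Continuous (u t) → Continuous (θ t) → (∀ x, 0 < θ t x) → let W : (N : ℕ) → Literature.Analysis.FluidPDE.Config (N + 1) (Fin 3) Literature.MathematicalPhysics.KineticTheory.T3 → ℝ := fun N => (Literature.Analysis.FluidPDE.hardSphereDomain (Literature.Analysis.FluidPDE.Torus.geometry (Fin 3)) (N + 1) (Literature.MathematicalPhysics.KineticTheory.hsDiameter σ N)).indicator (Literature.Analysis.FluidPDE.hsTransport (Φ N) t (Literature.Analysis.FluidPDE.canonicalDensity (Literature.Analysis.FluidPDE.Torus.geometry (Fin 3)) (Literature.MathematicalPhysics.KineticTheory.hsDiameter σ N) (N + 1) (Literature.MathematicalPhysics.KineticTheory.localGibbsProfile a₀ u₀ θ₀))); let g : Literature.MathematicalPhysics.KineticTheory.T3 × Literature.MathematicalPhysics.KineticTheory.V3 → ℝ := fun y => ρ t y.1 * Literature.Analysis.FluidPDE.localMaxwellian 1 (θ t y.1) (u t y.1) y.2; (∀ (N : ℕ)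 (π : Equiv.Perm (Fin (N + 1))), Filter.EventuallyEq (MeasureTheory.ae MeasureTheory.volume) (fun z => W N (z ∘ π)) (W N)) → Filter.Tendsto (fun N : ℕ => ∫⁻ y : Literature.MathematicalPhysics.KineticTheory.T3 × Literature.MathematicalPhysics.KineticTheory.V3, ENNReal.ofReal ((1 + ‖y.2‖ ^ 2) ^ 2 * |Literature.Analysis.FluidPDE.nthMarginal (N + 1) 1 (W N) (fun _ => y) - g y|)) Filter.atTop (nhds 0) → Filter.Tendsto (fun N : ℕ => ∫⁻ p : (Literature.MathematicalPhysics.KineticTheory.T3 × Literature.MathematicalPhysics.KineticTheory.V3) × (Literature.MathematicalPhysics.KineticTheory.T3 × Literature.MathematicalPhysics.KineticTheory.V3), ENNReal.ofReal ((1 + ‖p.1.2‖ ^ 2) * (1 + ‖p.2.2‖ ^ 2) * |Literature.Analysis.FluidPDE.nthMarginal (N + 1) 2 (W N) ![p.1, p.2] - Literature.Analysis.FluidPDE.nthMarginal (N + 1) 1 (W N) ![p.1] * Literature.Analysis.FluidPDE.nthMarginal (N + 1) 1 (W N) ![p.2]|)) Filter.atTop (nhds 0) → ∀ χ : Literature.MathematicalPhysics.KineticTheory.T3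 → ℝ, Continuous χ → Filter.Tendsto (fun N : ℕ => ∫⁻ z, ENNReal.ofReal (|Literature.MathematicalPhysics.KineticTheory.empiricalDensityField ((Φ N).flow t z) χ - ∫ x, χ x * ρ t x| ^ 2) ∂(Literature.MathematicalPhysics.KineticTheory.localGibbsLaw σ a₀ u₀ θ₀ N (Φ N))) Filter.atTop (nhds 0) ∧ Filter.Tendsto (fun N : ℕ => ∫⁻ z, ENNReal.ofReal (‖Literature.MathematicalPhysics.KineticTheory.empiricalMomentumField ((Φ N).flow t z) χ - ∫ x, (χ x * ρ t x) • u t x‖ ^ 2) ∂(Literature.MathematicalPhysics.KineticTheory.localGibbsLaw σ a₀ u₀ θ₀ N (Φ N))) Filter.atTop (nhds 0) ∧ Filter.Tendsto (fun N : ℕ => ∫⁻ z, ENNReal.ofReal (|Literature.MathematicalPhysics.KineticTheory.empiricalEnergyField ((Φ N).flow t z) χ - ∫ x, χ x * Literature.MathematicalPhysics.KineticTheory.totalEnergyDensity (ρ t x) (u t x) (θ t x)| ^ 2) ∂(Literature.MathematicalPhysics.KineticTheory.localGibbsLaw σ a₀ u₀ θ₀ N (Φ N))) Filter.atTop (nhds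 0)

/-- item stmt-AtomisticToContinuum-0801 · assembly · rank 1 · closed · moot by None · by planner
[assembly] L2HydroFields → HydrodynamicLimit: Markov/Chebyshev in ℝ≥0∞
(MeasureTheory.meas_ge_le_lintegral_div or mul_meas_ge_le_lintegral): P{δ < |F|} ≤ δ⁻² ∫⁻ ofReal
|F|², measurability of z ↦ field((Φ N).flow t z) from measurable_flow and continuity of χ (or use
the outer-measure form), then squeeze. -/
@[route_item "route-AtomisticToContinuum-DenseKineticExpansion"]
def Assembly : Prop :=
  L2HydroFields → Literature.MathematicalPhysics.KineticTheory.HydrodynamicLimit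

end Summit.AtomisticToContinuum.HydrodynamicLimit.Theses.DenseKineticExpansion
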